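import Summits.AtomisticToContinuum.HydrodynamicLimit.Theorems.AnnealedZeroHorizonDefs
import Summits.AtomisticToContinuum.HydrodynamicLimit.Theorems.BoxDissipativeWeakStrongLocalGibbsFineScalePos

/-!
# Crux `AnnealedWeakStrong` (stmt-AtomisticToContinuum-9258), line `registered`, stub S1
`stub_timeZeroMeanConvergence` — file A: admissible mollifiers and bounded convergence over the centre

Helper file (lead `prover-line-stmt-AtomisticToContinuum-9258-c1`, stub worker S1) for the registered stub
`stub_timeZeroMeanConvergence : Sig.stub_timeZeroMeanConvergence` (mean convergence of the `k`-mollified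
empirical fields at time `0` from convergence in probability). Model-free ingredients:

* `tendsto_lintegral_zero_of_forall` — bounded convergence on a finite measure space in the lower-integral
  format (for the integral over the centre `x ∈ 𝕋³`);
* admissible mollifiers `k ∈ Kernel(ℓ)` (`AWS.IsKernel`): a uniform bound, unit mass of the translates
  `k(x - ·)`, support in the minimal-image `ℓ`-ball around `x`, joint measurability, continuity of
  `x ↦ ∫ k(x - y) f(y) dy`, the mass bound `‖∫ k(x - y) f(y) dy‖ ≤ sup ‖f‖` and the **mollification bias**
  `‖∫ k(x - y) f(y) dy - f(x)‖ ≤ η` once `f` varies by at most `η` on minimal-image `ℓ`-balls.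

The registered helper theorem of this file is `stub_timeZeroMeanKernelBias : Sig.stub_timeZeroMeanKernelBias`
(the bias estimate, real-valued).
-/

noncomputable section

open MeasureTheory Filter Set
open scoped ENNReal Topology

namespace Summit.AtomisticToContinuum.HydrodynamicLimit.Theorems.AWS

open Literature.MathematicalPhysics.KineticTheory Literature.Analysis.FluidPDE

/-! ### Bounded convergence over the centre -/

/-- **Bounded convergence** on a finite measure space, lower-integral form: if measurable `F_N ≤ B`
converge to `0` pointwise then `∫⁻ F_N → 0`. -/
theorem tendsto_lintegral_zero_of_forall {α : Type*} [MeasurableSpace α] (μ : Measure α) [IsFiniteMeasure μ]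
    {F : ℕ → α → ℝ≥0∞} (hF : ∀ N, Measurable (F N)) {B : ℝ≥0∞} (hB : B ≠ ⊤) (hle : ∀ N x, F N x ≤ B)
    (hlim : ∀ x, Tendsto (fun N => F N x) atTop (𝓝 0)) :
    Tendsto (fun N => ∫⁻ x, F N x ∂μ) atTop (𝓝 0) := by
  have h := tendsto_lintegral_of_dominated_convergence (μ := μ) (fun _ => B) hF
    (fun N => ae_of_all _ (hle N))
    (by rw [lintegral_const]; exact ENNReal.mul_ne_top hB (measure_ne_top _ _))
    (ae_of_all _ hlim)
  simpa only [lintegral_zero] using h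

/-! ### Admissible mollifiers -/

section Kernel

variable {ℓ : ℝ} {k : T3 → ℝ}

/-- An admissible mollifier is bounded: `0 ≤ k ≤ K`. -/
theorem IsKernel.exists_le (hk : IsKernel ℓ k) : ∃ K : ℝ, 0 ≤ K ∧ ∀ y, k y ≤ K := by
  obtain ⟨K, hK0, hK⟩ := exists_forall_abs_le_of_continuous hk.1
  exact ⟨K, hK0, fun y => (le_abs_self _).trans (hK y)⟩

/-- The translates `k(x - ·)` of an admissible mollifier are continuous. -/
theorem IsKernel.continuous_translate (hk : IsKernel ℓ k) (x : T3) : Continuous fun y => k (x - y) :=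
  hk.1.comp (continuous_const.sub continuous_id)

/-- The translates `k(x - ·)` have unit mass (negation and translation invariance of Haar measure). -/
theorem IsKernel.integral_translate (hk : IsKernel ℓ k) (x : T3) : ∫ y, k (x - y) = 1 := by
  rw [MesoLLN.integral_comp_sub_left k x, hk.2.2.1]

/-- Where `k(x - y) ≠ 0` the points `x, y` are at minimal-image distance `< ℓ`. -/
theorem IsKernel.euclidDist_lt (hk : IsKernel ℓ k) {x y : T3} (h : k (x - y) ≠ 0) :
    Torus.euclidDist x y < ℓ := by
  have h1 := hk.2.2.2 (x - y) h
  rwa [MesoLLN.euclidDist_sub_zero] at h1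

/-- The kernel `(x, y) ↦ k(x - y)` is jointly measurable. -/
theorem IsKernel.measurable_uncurry (hk : IsKernel ℓ k) : Measurable fun p : T3 × T3 => k (p.1 - p.2) :=
  (hk.1.comp (continuous_fst.sub continuous_snd)).measurable

/-- Mollification `x ↦ ∫ k(x - y) f(y) dy` of a continuous `f` is continuous. -/
theorem IsKernel.continuous_integral_smul {F : Type*} [NormedAddCommGroup F] [NormedSpace ℝ F]
    (hk : IsKernel ℓ k) {f : T3 → F} (hf : Continuous f) : Continuous fun x => ∫ y, k (x - y) • f y := by
  have hc : Continuous (Function.uncurry fun (x y : T3) => k (x - y) • f y) :=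
    (hk.1.comp (continuous_fst.sub continuous_snd)).smul (hf.comp continuous_snd)
  have h := continuous_parametric_integral_of_continuous (μ := (volume : Measure T3)) hc isCompact_univ
  simpa only [Measure.restrict_univ] using h

/-- **Mass bound**: `‖∫ k(x - y) f(y) dy‖ ≤ M` when `‖f‖ ≤ M`. -/
theorem IsKernel.norm_integral_smul_le {F : Type*} [NormedAddCommGroup F] [NormedSpace ℝ F]
    (hk : IsKernel ℓ k) {f : T3 → F} {M : ℝ} (hM : ∀ y, ‖f y‖ ≤ M) (x : T3) :
    ‖∫ y, k (x - y) • f y‖ ≤ M := by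
  have hM0 : 0 ≤ M := (norm_nonneg _).trans (hM x)
  calc ‖∫ y, k (x - y) • f y‖ ≤ ∫ y, ‖k (x - y) • f y‖ := norm_integral_le_integral_norm _
    _ ≤ ∫ y, k (x - y) * M := by
        refine integral_mono_of_nonneg (ae_of_all _ fun y => norm_nonneg _)
          ((integrable_of_continuous_T3 (hk.continuous_translate x)).mul_const M) (ae_of_all _ fun y => ?_)
        dsimp only
        rw [norm_smul, Real.norm_eq_abs, abs_of_nonneg (hk.2.1 _)]
        exact mul_le_mul_of_nonneg_left (hM y) (hk.2.1 _)
    _ = M := by rw [integral_mul_const, hk.integral_translate x, one_mul]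

/-- **Mollification bias**: if `‖f x - f y‖ ≤ η` whenever `euclidDist x y < ℓ`, then
`‖∫ k(x - y) f(y) dy - f(x)‖ ≤ η` for every admissible mollifier `k ∈ Kernel(ℓ)` and every `x`. -/
theorem IsKernel.norm_integral_smul_sub_le {F : Type*} [NormedAddCommGroup F] [NormedSpace ℝ F]
    [CompleteSpace F] (hk : IsKernel ℓ k) {f : T3 → F} (hf : Continuous f) {η : ℝ}
    (hmod : ∀ x y, Torus.euclidDist x y < ℓ → ‖f x - f y‖ ≤ η) (x : T3) :
    ‖(∫ y, k (x - y) • f y) - f x‖ ≤ η := by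
  have hkc := hk.continuous_translate x
  have hi1 : Integrable (fun y => k (x - y) • f y) := integrable_of_continuous_T3 (hkc.smul hf)
  have hi2 : Integrable (fun y => k (x - y) • f x) := integrable_of_continuous_T3 (hkc.smul continuous_const)
  have hrepr : (∫ y, k (x - y) • f y) - f x = ∫ y, k (x - y) • (f y - f x) := by
    have hfx : f x = ∫ y, k (x - y) • f x := by rw [integral_smul_const, hk.integral_translate x, one_smul]
    conv_lhs => rw [hfx]
    rw [← integral_sub hi1 hi2]
    exact integral_congr_ae (ae_of_all _ fun y => (smul_sub _ _ _).symm)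
  rw [hrepr]
  calc ‖∫ y, k (x - y) • (f y - f x)‖ ≤ ∫ y, ‖k (x - y) • (f y - f x)‖ := norm_integral_le_integral_norm _
    _ ≤ ∫ y, k (x - y) * η := by
        refine integral_mono_of_nonneg (ae_of_all _ fun y => norm_nonneg _)
          ((integrable_of_continuous_T3 hkc).mul_const η) (ae_of_all _ fun y => ?_)
        dsimp only
        rw [norm_smul, Real.norm_eq_abs, abs_of_nonneg (hk.2.1 _)]
        by_cases hky : k (x - y) = 0
        · rw [hky, zero_mul, zero_mul]
        · refine mul_le_mul_of_nonneg_left ?_ (hk.2.1 _)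
          rw [← norm_neg, neg_sub]
          exact hmod x y (hk.euclidDist_lt hky)
    _ = η := by rw [integral_mul_const, hk.integral_translate x, one_mul]

end Kernel

/-! ### The registered helper theorem of this file -/

/-- **Signature of the registered helper `stub_timeZeroMeanKernelBias`** (S1, file A): the mollification
bias of an admissible mollifier on a real profile — if `|f x - f y| ≤ η` on minimal-image `ℓ`-balls then
`|∫ k(x - y) f(y) dy - f(x)| ≤ η` for all `k ∈ Kernel(ℓ)` and all `x`. -/
def Sig.stub_timeZeroMeanKernelBias : Prop :=
  ∀ (ℓ η : ℝ) (k f : T3 → ℝ), IsKernel ℓ k → Continuous f →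
    (∀ x y, Torus.euclidDist x y < ℓ → |f x - f y| ≤ η) → ∀ x, |(∫ y, k (x - y) * f y) - f x| ≤ η

/-- **Registered helper `stub_timeZeroMeanKernelBias`** (S1, file A): the mollification bias estimate
`Sig.stub_timeZeroMeanKernelBias`. -/
theorem stub_timeZeroMeanKernelBias : Sig.stub_timeZeroMeanKernelBias := by
  intro ℓ η k f hk hf hmod x
  have h := hk.norm_integral_smul_sub_le hf (fun x y hxy => by
    rw [Real.norm_eq_abs]; exact hmod x y hxy) x
  simpa only [smul_eq_mul, Real.norm_eq_abs] using h

end Summit.AtomisticToContinuum.HydrodynamicLimit.Theorems.AWS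

end
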